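import Literature.MathematicalPhysics.QuantumFieldTheory.Balaban1983to89.B9SectCDiffCutModelToy9

/-!
# `Balaban1983to89.B9SectCDiffCutModelToy10` — PACKAGING, PART 1: the per-sequence `(M)` BUNDLES of the cut model
with `∂ ≠ 0` at ONE constant free of `B`, `n`, `N`, and the first `TwoSeq` inhabitant with `∂ ≠ 0` (the DIAGONAL
datum) — the `∂*G` slot via the push-through `∂*G_d(ν) = G′(ν)∂*` and Toy9's weighted-row-norm algebra
(census `b2b-balaban-r1/SectC-inst-census.md` §6 (a⁵) ff.; notes N13–N16)

B9 = T. Bałaban, *Propagators for lattice gauge theories in a background field*, Commun. Math. Phys. **99**, 389–434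
(1985) [Balaban1985BackgroundPropagators].

CITATION HEADER (lean-in-tree rule 2026-08-18).  Cell `pub-balaban`, unit `b2b-balaban-r1-g17` (READER GROUP A,
lineage r1, gen 17), journal claim `SECTC-DIFF-CUTMODEL-TOY10` (fourth leaf of the seat, after `…Toy7` / `…Toy8` /
`…Toy9` under claims `SECTC-DIFF-CUTMODEL-TOY7` / `…-TOY8` / `…-TOY9`).  Source: doi:10.1007/bf01240355, held
`paper:balaban1985-cmp99-background-propagators`, journal page = PDF page + 388.  This unit re-read NO page and
introduces NO quotation: the only printed shapes inhabited here are the two per-sequence slot bundles `MOne` (seven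
slots `mQ mG mDG' mQ't mC mQ' mG'`) and `MTwo` (nine slots `mG mQt mDtG mDvG mG' mDG' mQ't mC mQ'`) of
`…B9SectCDiffAssembly`, which carry the scale powers of B9's Theorem 3.2 (3.48), p. 398 [PDF 10] (sentence quoted
VERBATIM in the header of `…B9SectCDiffAssembly`; the classes `𝒟(n, k, c)` transcribe Theorem 3.1 (3.42), p. 397
[PDF 9], quoted in the header of `…B9SectCDiffEstimate`), and the signature `TwoSeq` of `…B9SectCDiffExpansion`
((3.25)–(3.27), pp. 394–395, quoted there); the present declarations point to those quotations BY NAME only.  Tree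
inputs (by name): `B9SectCDiffEstimate.{OpDec}`, `B9SectCDiffAssembly.{MOne, MTwo}`, `B9SectCDiffExpansion.TwoSeq`,
`B9SectCDiffCutModelToy.{Qp, Qp_rowsum}`, `B9SectCDiffCutModelToy2.Qpt`, `B9SectCDiffCutModelToy3.{toyFrame,
opDec_of_rowsum, opDec_Qpt, opDec_zero_toy}`, `B9SectCDiffCutModelToy4.{Dfw, Dbw}`, `B9SectCDiffCutModelToy5.{Gr, Hm,
Gr_mul_Hm}`, `B9SectCDiffCutModelToy6.{Gd, Hd, Hd_mul_Gd, RowLe, RowLe.mul, ewt, E2}`, `B9SectCDiffCutModelToy7.{R1,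
R1_pos, srate_eq, rowLe_mono, isUnit_E2_num, E2_inv_opDec_num}`, `B9SectCDiffCutModelToy8.{MC, Lam, G0, Gtoy,
isUnit_MC_num, Gr_hG'_shape, E2inv_hC_shape, Gtoy_mul_eq_one_num}`, `B9SectCDiffCutModelToy9.{siteWt, isWt_siteWt,
RD, RD_nonneg, rowLe_G0, rowLe_DGr, rowLe_GrD, rowLe_add, rowLe_smul, rowLe_coarseLift, opDec_fine_of_rowLe,
Gtoy_eq_prod, qrate_eq, factor_sizes, Gtoy_opDec_num, Gr_opDec_num, DGr_opDec_num, opDec_toy_mono}`; Mathlib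
otherwise.  Cell rows: GAPS C-r1g13-1 (the cut model), C-r1g14-1 … C-r1g17-4 (the toys 1–9), this module's row
C-r1g17-5; census §6 (a⁵) / notes N10–N16.  No `HarnessLib` fact, no named-fact `Prop`, no `instance`, no new
predicate; no `sorry`.

## WHAT THIS MODULE DOES

Toy3's first inhabited `EstHyp` ran THEOREM D's pipeline with the DEGENERATE differential block `∂ = 0`, `G = C = G′ =
1`, at the `B`-dependent constant `c = B⁴`.  Toy7–Toy9 (this seat) produced the genuine sequence-1 operators of the
toy with `∂ = S − 1 ≠ 0` at mass `a/B` and certified each in the class of its slot with constants free of `B`, `n`,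
`N` (`E₂⁻¹ ∈ 𝒟(0,−4,3a⁴)`, `G′ ∈ 𝒟(0,2,40/(a(a−1)))`, `∂G′ ∈ 𝒟(0,1,224/(a−2))`, `Gtoy ∈ 𝒟(0,2,10¹⁰/a²)`).  This
module does the first half of the packaging:

* §1 THE `∂*G` SLOT (the one sequence-2 slot with new content): the push-through identity **`pushThrough_Dbw_Gd :
  Dbw·Gd(ν) = Gr(ν)·Dbw`** (the step inside Toy8's `Dbw_Gd_Dfw`, exported), `Dbw_G0_eq_smul : ∂*G₀ = ½G′(ν)∂*`,
  `Dbw_Gtoy_eq_prod` (`∂*G = ∂*G₀ + (∂*G₀)(∂G′)(Q′ᵗM_C⁻¹Q′)(G′∂*)G₀`, five square fine factors), `rowLe_DbwG0`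
  (`N(∂*G₀) ≤ R_D(l)/2`) and the symbolic norm **`rowLe_DbwGtoy : N(∂*G) ≤ R_D(l)/2 + (R_D(l)/2)·R_D(m)·R_M·R_D(m)·
  (R₁(l)/2)`** in Toy9's `RowLe (siteWt κ)` algebra (no rate loss);
* §2 NUMBERS at `κ = 1/2`, `m = l = a/B`, `2²⁰ ≤ a ≤ B`: **`rowLe_DbwGtoy_num : N(∂*G) ≤ 3·10¹⁰·B/a`** (`224 +
  224·448·16·448·40 = 28 772 925 664 ≤ 3·10¹⁰`; B-power bookkeeping `1 + 1 − 4 + 1 + 2 = 1`) and **`DbwGtoy_opDec_num :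
  ∂*G ∈ 𝒟(0, 1, 3·10¹⁰/a)`** on `toyFrame n B N hN δ₀` (`δ₀ ≤ 1/2`) — the `MTwo.mDtG` SHAPE; `bundle_consts`: every
  per-slot constant (`1`, `10¹⁰/a²`, `224/(a−2)`, `40/(a(a−1))`, `20/(a(a−1))`, `3·10¹⁰/a`) is `≤ 3a⁴`, the `mC`
  constant, which therefore serves as the ONE constant;
* §3 **`mOne_of_seq1`** — THE PARAMETRIC `(M)` BUNDLE OF SEQUENCE 1 WITH `∂ ≠ 0`: for ANY `X : TwoSeq` on the toy
  carriers (sequence-2 carriers arbitrary) whose sequence-1 operators are the genuine toy ones (`Q₁ = Q′₁ = Q′`,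
  `Q′*₁ = Qpt`, `∂ = Dfw`, `G′₁ = Gr(μ)`, `C₁ = E₂(μ)⁻¹`, `G₁ = Gtoy(μ,μ)`, `μ = (a/B)²`),
  `MOne (toyFrame n B N hN δ₀) X id Prod.fst Prod.fst id id (3a⁴)` for `2²⁰ ≤ a ≤ B`, `δ₀ ≤ 1/2` — so the successor's
  genuine two-sequence datum inherits the sequence-1 bundle for free;
* §4 **`Xdiag`** — THE DIAGONAL DATUM, the first inhabitant of `TwoSeq` with `∂ ≠ 0`: both sequences carry the genuine
  operators (`χ = ψ = 1`, `∂ = Dfw`, `∂* = Dbw`, `Λ = Lam(μ) = 2μ + ∂∂*`, `Λ′ = μ·1`, `A = A′ = 0`, `Q = Q′`,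
  `Q* = Q′* = Qpt`, `G′ = Gr(μ)`, `C = E₂(μ)⁻¹`, `G = Gtoy(μ,μ)`), the six inverse identities (LEFT for sequence 1,
  RIGHT for sequence 2) discharged by Toy8's three shape theorems and `mul_eq_one_comm`; projection `simp` lemmas
  `Xdiag_*`; and its bundles **`mOne_Xdiag`** (`MOne … (3a⁴)`, from §3 by `rfl`s) and **`mTwo_Xdiag`** (`MTwo …
  Prod.fst Prod.fst Prod.fst id id (∇ := 0) (3a⁴)`, nine slots, `mDtG` from §2).

## WHAT IS NOT CLAIMED (ABSOLUTE RULE)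

Nothing printed is asserted.  Everything here is finite-dimensional linear algebra and finite sums of exponentials over
the one-dimensional toy (folklore); B9's Theorems 3.1–3.3 concern gauge-covariant operators in a background field on a
four-dimensional multi-level lattice, and nothing here bears on them or on their printed proofs.  HONEST CAVEATS:
(1) `Xdiag` has IDENTICAL sequences — their difference vanishes, so it is an inhabitant of the `TwoSeq` SIGNATURE with
`∂ ≠ 0` and a consistency check of the six equations, NOT a cut model with content: the genuine second sequence (Toy3's
window/left-site averaging `Q2`, `Q2t` on `S2 = Win ⊕ Lft` carrying THESE operators, whose coarse operators `E`, `M_C`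
on `S2` must be inverted afresh), the `(L)` bundle with Toy4's Leibniz block at `b = 1`, the zone classes, `CutModel`
and `EstHyp` with `∂ ≠ 0`, an `n`-free majorant profile and the `b = 0` reading are NOT done (census §6 (a⁵) ff., note
N16); (2) `∇ := 0` in `mTwo_Xdiag` (no 2-tensor carrier in `d = 1`) makes the slot `mDvG` trivial; (3) the constant
`3a⁴` and the threshold `a ≥ 2²⁰` are artefacts of Toy7–Toy9's crude inputs; nothing was optimised.  Value = kernel
certificate that the per-sequence factor bundles of THEOREM D's hypothesis record are inhabited, with `∂ ≠ 0` and one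
absolute constant, by the genuine toy operators — NOT summit progress.
-/

namespace Literature.MathematicalPhysics.QuantumFieldTheory.Balaban1983to89.B9SectCDiffCutModelToy10

open Finset Real
open B9SectCDiffEstimate
open B9SectCDiffAssembly
open B9SectCDiffExpansion (TwoSeq)
open B9SectCDiffCutModel
open B9SectCDiffCutModelToy
open B9SectCDiffCutModelToy2
open B9SectCDiffCutModelToy3
open B9SectCDiffCutModelToy4
open B9SectCDiffCutModelToy5
open B9SectCDiffCutModelToy6
open B9SectCDiffCutModelToy7
open B9SectCDiffCutModelToy8
open B9SectCDiffCutModelToy9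

noncomputable section

/-! ## §1 The push-through identity and the `∂*G` slot -/

section DtG

variable {n B : ℕ} {m l κ ν : ℝ}

/-- **PUSH-THROUGH**: `∂*(∂∂* + ν)⁻¹ = (∂*∂ + ν)⁻¹∂*`, i.e. `Dbw·Gd(ν) = Gr(ν)·Dbw` (from `H_ν∂* = ∂*H₀,ν`; the
step inside Toy8's `Dbw_Gd_Dfw`, exported). [folklore] -/
theorem pushThrough_Dbw_Gd (hν : 0 < ν) : Dbw n B * Gd n B ν = Gr n B ν * Dbw n B := by
  have h1 : Hm n B ν * Dbw n B = Dbw n B * Hd n B ν := by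
    unfold Hm Hd
    simp only [Matrix.add_mul, Matrix.mul_add, Matrix.smul_mul, Matrix.mul_smul, Matrix.one_mul, Matrix.mul_one,
      Matrix.mul_assoc]
  calc Dbw n B * Gd n B ν = Gr n B ν * Hm n B ν * Dbw n B * Gd n B ν := by rw [Gr_mul_Hm hν, Matrix.one_mul]
    _ = Gr n B ν * (Hm n B ν * Dbw n B) * Gd n B ν := by rw [Matrix.mul_assoc (Gr n B ν)]
    _ = Gr n B ν * (Dbw n B * Hd n B ν) * Gd n B ν := by rw [h1]
    _ = Gr n B ν * Dbw n B := by rw [Matrix.mul_assoc, Matrix.mul_assoc, Hd_mul_Gd hν, Matrix.mul_one]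

/-- `∂*G₀ = ½·G′(ν)∂*`. [folklore] -/
theorem Dbw_G0_eq_smul (hν : 0 < ν) : Dbw n B * G0 n B ν = (1 / 2 : ℝ) • (Gr n B ν * Dbw n B) := by
  unfold G0; rw [Matrix.mul_smul, pushThrough_Dbw_Gd hν]

/-- `∂*G` as a sum of products of SQUARE fine factors:
`∂*G = ∂*G₀ + (∂*G₀)·(∂G′)·(Q′ᵗM_C⁻¹Q′)·(G′∂*)·G₀`. [folklore] -/
theorem Dbw_Gtoy_eq_prod (μ ν : ℝ) :
    Dbw n B * Gtoy n B μ ν = Dbw n B * G0 n B ν + Dbw n B * G0 n B ν * (Dfw n B * Gr n B μ)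
      * (Qpt n B * (MC n B μ ν)⁻¹ * Qp n B) * (Gr n B μ * Dbw n B) * G0 n B ν := by
  rw [Gtoy_eq_prod, Matrix.mul_add]; simp only [Matrix.mul_assoc]

/-- `N(∂*G₀) ≤ R_D(l)/2` at the block weight (mass `l²`, rate `l/4 − κ/B > 0`). [folklore] -/
theorem rowLe_DbwG0 (hl0 : 0 < l) (hl1 : l ≤ 1) (hκ : 0 ≤ κ) (hB : 0 < B) (hs : 0 < l / 4 - κ / B) :
    RowLe (siteWt n B κ) (Dbw n B * G0 n B (l ^ 2)) (RD B l κ / 2) := by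
  have h := rowLe_smul (rowLe_GrD (n := n) hl0 hl1 hκ hB hs) (1 / 2 : ℝ)
  rw [abs_of_pos (by norm_num : (0 : ℝ) < 1 / 2)] at h
  rw [Dbw_G0_eq_smul (by positivity), show RD B l κ / 2 = 1 / 2 * RD B l κ by ring]
  exact h

/-- **THE BLOCK-WEIGHTED ROW NORM OF `∂*G`** (symbolic):
`N(∂*G) ≤ R_D(l)/2 + (R_D(l)/2)·R_D(m)·R_M·R_D(m)·(R₁(l)/2)`. [folklore] -/
theorem rowLe_DbwGtoy (hm0 : 0 < m) (hm1 : m ≤ 1) (hl0 : 0 < l) (hl1 : l ≤ 1) (hκ : 0 ≤ κ) (hB : 0 < B)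
    (hsm : 0 < m / 4 - κ / B) (hsl4 : 0 < l / 4 - κ / B) (hsl : 0 < l / 2 - κ / B) {RM : ℝ} (hRM : 0 ≤ RM)
    (hMC : RowLe (ewt n κ) (MC n B (m ^ 2) (l ^ 2))⁻¹ RM) :
    RowLe (siteWt n B κ) (Dbw n B * Gtoy n B (m ^ 2) (l ^ 2))
      (RD B l κ / 2 + RD B l κ / 2 * RD B m κ * RM * RD B m κ * (R1 B l κ / 2)) := by
  have hw := isWt_siteWt (n := n) (B := B) hκ
  have hD0 := rowLe_DbwG0 (n := n) hl0 hl1 hκ hB hsl4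
  have hG0 := rowLe_G0 (n := n) hl0 hl1 hκ hB hsl
  have hA := rowLe_DGr (n := n) hm0 hm1 hκ hB hsm
  have hC := rowLe_GrD (n := n) hm0 hm1 hκ hB hsm
  have hL := rowLe_coarseLift hB hMC
  have hRD := RD_nonneg (B := B) hsm
  have hR1 : 0 ≤ R1 B l κ / 2 := by have := R1_pos (B := B) hl0 hsl; positivity
  rw [Dbw_Gtoy_eq_prod]
  exact rowLe_add hw hD0
    (RowLe.mul hw (RowLe.mul hw (RowLe.mul hw (RowLe.mul hw hD0 hA hRD) hL hRM) hC hRD) hG0 hR1)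

end DtG

/-! ## §2 Numeric: the `∂*G` slot at `m = l = a/B`, and the weights of the one constant `3a⁴` -/

section Numeric

variable {n B : ℕ} {N : Finset (Fin n)} {hN : N.Nonempty} {δ₀ a : ℝ}

/-- `N(∂*G) ≤ 3·10¹⁰·B/a` at `m = l = a/B`, `κ = 1/2`, for `2²⁰ ≤ a ≤ B`
(`224 + 224·448·16·448·40 = 28 772 925 664 ≤ 3·10¹⁰`). [folklore] -/
theorem rowLe_DbwGtoy_num (ha : 1048576 ≤ a) (haB : a ≤ (B : ℝ)) :
    RowLe (siteWt n B (1 / 2)) (Dbw n B * Gtoy n B ((a / B) ^ 2) ((a / B) ^ 2)) (3 * 10 ^ 10 / a * (B : ℝ)) := by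
  have ha0 : 0 < a := by linarith
  have hBr : (0 : ℝ) < B := by linarith
  have hB : 0 < B := by exact_mod_cast hBr
  have hm0 : 0 < a / B := by positivity
  have hm1 : a / B ≤ 1 := by rwa [div_le_one hBr]
  have hsm : 0 < a / B / 4 - 1 / 2 / (B : ℝ) := by rw [qrate_eq]; exact div_pos (div_pos (by linarith) hBr) four_pos
  have hsl : 0 < a / B / 2 - 1 / 2 / (B : ℝ) := by rw [srate_eq]; exact div_pos (div_pos (by linarith) hBr) two_pos
  obtain ⟨_, hMC⟩ := isUnit_MC_num (n := n) ha haB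
  have hRM : 0 ≤ 4 * ((B : ℝ) ^ 4 * (a - 6) ^ 2 / a ^ 6)⁻¹ := by
    have : 0 ≤ (B : ℝ) ^ 4 * (a - 6) ^ 2 / a ^ 6 := by positivity
    positivity
  have h := rowLe_DbwGtoy (n := n) hm0 hm1 hm0 hm1 (by norm_num) hB hsm hsm hsl hRM hMC
  obtain ⟨hX, hY, hZ⟩ := factor_sizes ha haB
  have hY2 : RD B (a / B) (1 / 2) / 2 ≤ 224 * B / a := by
    have : 224 * (B : ℝ) / a = 448 * B / a / 2 := by ring
    rw [this]; linarith
  have hX0 : 0 ≤ R1 B (a / B) (1 / 2) / 2 := by have := R1_pos (B := B) hm0 hsl; positivity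
  have hY0 : 0 ≤ RD B (a / B) (1 / 2) := RD_nonneg hsm
  refine rowLe_mono h ?_
  calc RD B (a / B) (1 / 2) / 2 + RD B (a / B) (1 / 2) / 2 * RD B (a / B) (1 / 2)
          * (4 * ((B : ℝ) ^ 4 * (a - 6) ^ 2 / a ^ 6)⁻¹) * RD B (a / B) (1 / 2) * (R1 B (a / B) (1 / 2) / 2)
      ≤ 224 * (B : ℝ) / a
          + 224 * (B : ℝ) / a * (448 * B / a) * (16 * a ^ 4 / (B : ℝ) ^ 4) * (448 * B / a)
            * (40 * (B : ℝ) ^ 2 / a ^ 2) := by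
        gcongr
    _ = (224 + 224 * 448 * 16 * 448 * 40) * (B : ℝ) / a := by field_simp
    _ ≤ 3 * 10 ^ 10 / a * (B : ℝ) := by
        rw [div_mul_eq_mul_div]
        exact div_le_div_of_nonneg_right (mul_le_mul_of_nonneg_right (by norm_num) hBr.le) ha0.le

/-- **`∂*G ∈ 𝒟(0, 1, 3·10¹⁰/a)` ON THE TOY FRAME** for `2²⁰ ≤ a ≤ B`, `δ₀ ≤ 1/2` — the `MTwo.mDtG` SHAPE
(B-power bookkeeping `1 + 1 − 4 + 1 + 2 = 1`). [folklore] -/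
theorem DbwGtoy_opDec_num (ha : 1048576 ≤ a) (haB : a ≤ (B : ℝ)) (hδ : δ₀ ≤ 1 / 2) :
    OpDec (toyFrame n B N hN δ₀) Prod.fst Prod.fst id id 0 1 (3 * 10 ^ 10 / a)
      (Dbw n B * Gtoy n B ((a / B) ^ 2) ((a / B) ^ 2)) := by
  have ha0 : 0 < a := by linarith
  refine opDec_fine_of_rowLe (by norm_num) hδ (rowLe_DbwGtoy_num ha haB) (by positivity) (le_of_eq ?_)
  rw [zpow_one]

/-- `0 < (a/B)²` for `2²⁰ ≤ a ≤ B`. [folklore] -/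
theorem muB_pos (ha : 1048576 ≤ a) (haB : a ≤ (B : ℝ)) : 0 < (a / B) ^ 2 := by
  have ha0 : 0 < a := by linarith
  have hBr : (0 : ℝ) < B := by linarith
  positivity

/-- the weights of the ONE constant `c = 3a⁴` (`2²⁰ ≤ a`): every per-slot constant of Toy7/Toy9/§2 is below it.
[folklore] -/
theorem bundle_consts (ha : 1048576 ≤ a) :
    (1 : ℝ) ≤ 3 * a ^ 4 ∧ 10 ^ 10 / a ^ 2 ≤ 3 * a ^ 4 ∧ 224 / (a - 2) ≤ 3 * a ^ 4
      ∧ 40 / (a * (a - 1)) ≤ 3 * a ^ 4 ∧ 20 / (a * (a - 1)) ≤ 3 * a ^ 4 ∧ 3 * 10 ^ 10 / a ≤ 3 * a ^ 4 := by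
  have ha1 : (1 : ℝ) ≤ a := by linarith
  have ha0 : (0 : ℝ) < a := by linarith
  have hA2 : (1048576 : ℝ) ^ 2 ≤ a ^ 2 := pow_le_pow_left₀ (by norm_num) ha 2
  have ha4 : a ≤ 3 * a ^ 4 := by
    have : a ^ 4 = a * a ^ 3 := by ring
    nlinarith [one_le_pow₀ (n := 3) ha1]
  have h1 : (1 : ℝ) ≤ 3 * a ^ 4 := ha1.trans ha4
  refine ⟨h1, ?_, ?_, ?_, ?_, ?_⟩
  · refine le_trans ?_ ha4
    rw [div_le_iff₀ (by positivity)]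
    calc (10 : ℝ) ^ 10 ≤ 1048576 * 1048576 ^ 2 := by norm_num
      _ ≤ a * a ^ 2 := mul_le_mul ha hA2 (by positivity) ha0.le
  · refine le_trans ?_ h1
    rw [div_le_iff₀ (by linarith)]; linarith
  · refine le_trans ?_ h1
    rw [div_le_iff₀ (by nlinarith)]; nlinarith
  · refine le_trans ?_ h1
    rw [div_le_iff₀ (by nlinarith)]; nlinarith
  · refine le_trans ?_ ha4
    rw [div_le_iff₀ ha0]
    calc (3 : ℝ) * 10 ^ 10 ≤ 1048576 * 1048576 := by norm_num
      _ ≤ a * a := mul_le_mul ha ha (by norm_num) ha0.le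

end Numeric

/-! ## §3 The PARAMETRIC (M) bundle of sequence 1 with `∂ ≠ 0` at ONE constant -/

section Bundle

variable {n B : ℕ} {N : Finset (Fin n)} {hN : N.Nonempty} {δ₀ a : ℝ}
variable {S₂ B₂ : Type} [Fintype S₂] [DecidableEq S₂] [Fintype B₂]

/-- **(M) OF SEQUENCE 1 WITH `∂ ≠ 0` AT `c = 3a⁴`** (parametric in the rest of the datum): for ANY two-sequence
system on the toy carriers whose sequence-1 operators are the genuine toy ones — `Q₁ = Q′₁ = Q′`,
`Q′*₁ = Qpt`, `∂ = Dfw`, `G′₁ = Gr(μ)`, `C₁ = E₂(μ)⁻¹`, `G₁ = Gtoy(μ, μ)`, `μ = (a/B)²` — the seven slots of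
`MOne` hold on the toy frame at the ONE constant `3a⁴` (free of `B`, `n`, `N`) for `2²⁰ ≤ a ≤ B`, `δ₀ ≤ 1/2`:
`mQ`/`mQ'` (Toy2/Toy3 `opDec_of_rowsum`), `mQ't` (`opDec_Qpt`), `mC` (Toy7 `E2_inv_opDec_num`, which FIXES the
constant), `mG'`/`mDG'`/`mG` (Toy9 `Gr_opDec_num`/`DGr_opDec_num`/`Gtoy_opDec_num`), unified by `opDec_toy_mono`.
Compare Toy3's `toyMOne`: `G = C = G′ = 1`, `∂ = 0`, `c = B⁴`. [folklore] -/
theorem mOne_of_seq1 (X : TwoSeq (Fin n × Fin B) (Fin n × Fin B) (Fin n) S₂ (Fin n) B₂)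
    (hQ : X.Q₁ = Qp n B) (hG : X.G₁ = Gtoy n B ((a / B) ^ 2) ((a / B) ^ 2)) (hD : X.D = Dfw n B)
    (hG' : X.G'₁ = Gr n B ((a / B) ^ 2)) (hQt : X.Q't₁ = Qpt n B) (hC : X.C₁ = (E2 n B ((a / B) ^ 2))⁻¹)
    (hQ' : X.Q'₁ = Qp n B) (ha : 1048576 ≤ a) (haB : a ≤ (B : ℝ)) (hδ : δ₀ ≤ 1 / 2) :
    MOne (toyFrame n B N hN δ₀) X id Prod.fst Prod.fst id id (3 * a ^ 4) := by
  have ha0 : 0 < a := by linarith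
  have hBr : (0 : ℝ) < B := by linarith
  have hB : 0 < B := by exact_mod_cast hBr
  obtain ⟨h1, hcG, hcD, hcGr, -, -⟩ := bundle_consts ha
  exact
    { mQ := by rw [hQ]; exact opDec_of_rowsum (Qp_rowsum hB) h1
      mG := by rw [hG]; exact opDec_toy_mono (Gtoy_opDec_num ha haB hδ) (by positivity) hcG
      mDG' := by
        rw [hD, hG']
        exact opDec_toy_mono (DGr_opDec_num (by linarith) haB hδ) (by
          have : 0 < a - 2 := by linarith
          positivity) hcD
      mQ't := by rw [hQt]; exact opDec_Qpt h1
      mC := by rw [hC]; exact E2_inv_opDec_num (by linarith) haB hδ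
      mQ' := by rw [hQ']; exact opDec_of_rowsum (Qp_rowsum hB) h1
      mG' := by
        rw [hG']
        exact opDec_toy_mono (Gr_opDec_num (by linarith) haB hδ) (by
          have : 0 < a - 1 := by linarith
          positivity) hcGr }

end Bundle

/-! ## §4 The DIAGONAL datum: the first `TwoSeq` inhabitant with `∂ ≠ 0` -/

section Diag

variable {n B : ℕ} {N : Finset (Fin n)} {hN : N.Nonempty} {δ₀ : ℝ}

/-- **THE DIAGONAL DATUM** `Xdiag`: both sequences carry the genuine toy operators with `∂ ≠ 0` — fine carriers
sites = bonds = `Fin n × Fin B`, all four coarse carriers `Fin n`; `χ = ψ = 1`; `∂ = Dfw`, `∂* = Dbw`,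
`Λ = Lam(μ) = 2μ + ∂∂*`, `Λ′ = μ·1`, `A = A′ = 0`; `Q = Q′ = Q′` (block averaging), `Q* = Q′* = Qpt`;
`G′ = Gr(μ)`, `C = E₂(μ)⁻¹`, `G = Gtoy(μ, μ)`, `μ = (a/B)²`, `2²⁰ ≤ a ≤ B`; the SIX inverse identities (left for
sequence 1, right for sequence 2) discharged by Toy8's `Gr_hG'_shape`, `E2inv_hC_shape`, `Gtoy_mul_eq_one_num` and
`mul_eq_one_comm`.  HONEST: the two sequences COINCIDE, so their difference vanishes — this is an inhabitant of
the `TwoSeq` signature with `∂ ≠ 0`, NOT a cut model with content.  OURS (typing + the identities). [folklore] -/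
def Xdiag (n B : ℕ) (a : ℝ) (ha : 1048576 ≤ a) (haB : a ≤ (B : ℝ)) :
    TwoSeq (Fin n × Fin B) (Fin n × Fin B) (Fin n) (Fin n) (Fin n) (Fin n) where
  χs := 1
  χb := 1
  ψS := 1
  ψB := 1
  D := Dfw n B
  Dt := Dbw n B
  Λ := Lam n B ((a / B) ^ 2)
  Λ' := ((a / B) ^ 2 : ℝ) • (1 : Matrix (Fin n × Fin B) (Fin n × Fin B) ℝ)
  Q₁ := Qp n B
  Q₂ := Qp n B
  Qt₁ := Qpt n B
  Qt₂ := Qpt n B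
  Q'₁ := Qp n B
  Q'₂ := Qp n B
  Q't₁ := Qpt n B
  Q't₂ := Qpt n B
  A₁ := 0
  A₂ := 0
  A'₁ := 0
  A'₂ := 0
  G'₁ := Gr n B ((a / B) ^ 2)
  G'₂ := Gr n B ((a / B) ^ 2)
  C₁ := (E2 n B ((a / B) ^ 2))⁻¹
  C₂ := (E2 n B ((a / B) ^ 2))⁻¹
  G₁ := Gtoy n B ((a / B) ^ 2) ((a / B) ^ 2)
  G₂ := Gtoy n B ((a / B) ^ 2) ((a / B) ^ 2)
  hG'₁ := Gr_hG'_shape (muB_pos ha haB)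
  hG'₂ := mul_eq_one_comm.mp (Gr_hG'_shape (muB_pos ha haB))
  hC₁ := E2inv_hC_shape (isUnit_E2_num (by linarith) haB).1
  hC₂ := mul_eq_one_comm.mp (E2inv_hC_shape (isUnit_E2_num (by linarith) haB).1)
  hG₁ := Gtoy_mul_eq_one_num ha haB
  hG₂ := mul_eq_one_comm.mp (Gtoy_mul_eq_one_num ha haB)

variable {a : ℝ} {ha : 1048576 ≤ a} {haB : a ≤ (B : ℝ)}

/-- projection of the diagonal datum: `∂ = Dfw`. [folklore] -/
@[simp] theorem Xdiag_D : (Xdiag n B a ha haB).D = Dfw n B := rfl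
/-- projection of the diagonal datum: `∂* = Dbw`. [folklore] -/
@[simp] theorem Xdiag_Dt : (Xdiag n B a ha haB).Dt = Dbw n B := rfl
/-- projection of the diagonal datum: `Q₁ = Q′`. [folklore] -/
@[simp] theorem Xdiag_Q₁ : (Xdiag n B a ha haB).Q₁ = Qp n B := rfl
/-- projection of the diagonal datum: `Q′₁ = Q′`. [folklore] -/
@[simp] theorem Xdiag_Q'₁ : (Xdiag n B a ha haB).Q'₁ = Qp n B := rfl
/-- projection of the diagonal datum: `Q′₂ = Q′`. [folklore] -/
@[simp] theorem Xdiag_Q'₂ : (Xdiag n B a ha haB).Q'₂ = Qp n B := rfl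
/-- projection of the diagonal datum: `Q*₂ = Qpt`. [folklore] -/
@[simp] theorem Xdiag_Qt₂ : (Xdiag n B a ha haB).Qt₂ = Qpt n B := rfl
/-- projection of the diagonal datum: `Q′*₁ = Qpt`. [folklore] -/
@[simp] theorem Xdiag_Q't₁ : (Xdiag n B a ha haB).Q't₁ = Qpt n B := rfl
/-- projection of the diagonal datum: `Q′*₂ = Qpt`. [folklore] -/
@[simp] theorem Xdiag_Q't₂ : (Xdiag n B a ha haB).Q't₂ = Qpt n B := rfl
/-- projection of the diagonal datum: `G′₁ = Gr(μ)`. [folklore] -/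
@[simp] theorem Xdiag_G'₁ : (Xdiag n B a ha haB).G'₁ = Gr n B ((a / B) ^ 2) := rfl
/-- projection of the diagonal datum: `G′₂ = Gr(μ)`. [folklore] -/
@[simp] theorem Xdiag_G'₂ : (Xdiag n B a ha haB).G'₂ = Gr n B ((a / B) ^ 2) := rfl
/-- projection of the diagonal datum: `C₁ = E₂⁻¹`. [folklore] -/
@[simp] theorem Xdiag_C₁ : (Xdiag n B a ha haB).C₁ = (E2 n B ((a / B) ^ 2))⁻¹ := rfl
/-- projection of the diagonal datum: `C₂ = E₂⁻¹`. [folklore] -/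
@[simp] theorem Xdiag_C₂ : (Xdiag n B a ha haB).C₂ = (E2 n B ((a / B) ^ 2))⁻¹ := rfl
/-- projection of the diagonal datum: `G₁ = Gtoy`. [folklore] -/
@[simp] theorem Xdiag_G₁ : (Xdiag n B a ha haB).G₁ = Gtoy n B ((a / B) ^ 2) ((a / B) ^ 2) := rfl
/-- projection of the diagonal datum: `G₂ = Gtoy`. [folklore] -/
@[simp] theorem Xdiag_G₂ : (Xdiag n B a ha haB).G₂ = Gtoy n B ((a / B) ^ 2) ((a / B) ^ 2) := rfl

/-- **(M) OF SEQUENCE 1 for the diagonal datum at `c = 3a⁴`** (`δ₀ ≤ 1/2`). [folklore] -/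
theorem mOne_Xdiag (hδ : δ₀ ≤ 1 / 2) :
    MOne (toyFrame n B N hN δ₀) (Xdiag n B a ha haB) id Prod.fst Prod.fst id id (3 * a ^ 4) :=
  mOne_of_seq1 (Xdiag n B a ha haB) rfl rfl rfl rfl rfl rfl rfl ha haB hδ

/-- **(M) OF SEQUENCE 2 for the diagonal datum at `c = 3a⁴`** with `∇ := 0` (no 2-tensors in `d = 1`): the nine
slots of `MTwo` — `mG` (`Gtoy_opDec_num`), `mQt`/`mQ't` (`opDec_Qpt`), `mDtG` (§2 `DbwGtoy_opDec_num`), `mDvG`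
(zero), `mG'` (`Gr_opDec_num`), `mDG'` (`DGr_opDec_num`), `mC` (`E2_inv_opDec_num`), `mQ'` (`opDec_of_rowsum`).
[folklore] -/
theorem mTwo_Xdiag (hδ : δ₀ ≤ 1 / 2) :
    MTwo (toyFrame n B N hN δ₀) (Xdiag n B a ha haB) id Prod.fst Prod.fst Prod.fst id id
      (0 : Matrix (Fin n × Fin B) (Fin n × Fin B) ℝ) (3 * a ^ 4) := by
  have ha0 : 0 < a := by linarith
  have hBr : (0 : ℝ) < B := by linarith
  have hB : 0 < B := by exact_mod_cast hBr
  obtain ⟨h1, hcG, hcD, hcGr, -, hcDt⟩ := bundle_consts ha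
  exact
    { mG := opDec_toy_mono (Gtoy_opDec_num ha haB hδ) (by positivity) hcG
      mQt := opDec_Qpt h1
      mDtG := opDec_toy_mono (DbwGtoy_opDec_num ha haB hδ) (by positivity) hcDt
      mDvG := by
        rw [Matrix.zero_mul]
        exact opDec_zero_toy _ _ _ _ 0 1 (by positivity)
      mG' := opDec_toy_mono (Gr_opDec_num (by linarith) haB hδ) (by
          have : 0 < a - 1 := by linarith
          positivity) hcGr
      mDG' := opDec_toy_mono (DGr_opDec_num (by linarith) haB hδ) (by
          have : 0 < a - 2 := by linarith
          positivity) hcD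
      mQ't := opDec_Qpt h1
      mC := E2_inv_opDec_num (by linarith) haB hδ
      mQ' := opDec_of_rowsum (Qp_rowsum hB) h1 }

end Diag

end

end Literature.MathematicalPhysics.QuantumFieldTheory.Balaban1983to89.B9SectCDiffCutModelToy10
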